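import Summits.QuantumFields.BalabanUV.Beta.GAN24.E3SlotDivergence

/-!
# `BalabanUV.Beta.GAN24.BlockDivergenceFlux` — binder row G-an2-4 ∕ (CONV-C), CT-W (route WC-TL): THE BLOCK SUM OF A LATTICE DIVERGENCE IS THE FACE FLUX —
# `Σ_{v ∈ box} divV S (N•y + v) = Σ_μ (ENTERING face sum − EXITING face sum)`, so the storey maps of T-EQ (`divW_lin4_of_symm`, `divV_e3OfK`) read a
# table ONLY through its values on the two `μ`-faces of the block `B(y)` (G-an2-4 formalisation swarm, leaf prover `b2b-balaban-gan24-formalise-leaf-03`,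
# gen 58; idea-1 g32's WARD5 §3 LAYER lemma (3.2) ∕ the OWNER gan24-p1 g24's R7 (E2) «exit-face sum» — in the kernel; module name PROVISIONAL)

NOT IN PRINT; OUR BOOKKEEPING.  HONEST FRAMING (cell contract, verbatim): «discharging `BetaPertH` makes Bałaban's UV stability
UNCONDITIONAL — a real constructive-QFT result; it is NOT the continuum limit and NOT the Clay problem.»  HONEST DEPENDENCY (verbatim):
«continuum YM on T⁴ ⇐ BetaPertH ∧ nine spine estimates (0/9 proved); BetaPertH ⇐ (D1) ∧ (D4) ∧ CAP+tail; G-an2-4 gates asym, D1 and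
NE2/3/4.»

WHAT ([folklore] finite-sum bookkeeping; `box (d+1) N = {0,…,N−1}^{d+1}` (`AffineAveraging.box`), `N ≥ 1`; the ENTERING `μ`-face `{v ∈ box ∣ v μ = 0}`, the
EXITING `μ`-face `{v ∈ box ∣ v μ = N − 1}`, written as `Finset.filter`s — 0 `def`, 0 cite, 0 `def … : Prop`, 0 sorry):
* §0 (ANY finite region `B`, the OWNER gan24-p1 g25's W2 (LAY) general form) `finsetSum_sub_shift_eq_layers`, **`finsetSum_divV_eq_layers`** —
  `Σ_{u ∈ B} divV S u = Σ_μ (Σ_{(B − e_μ) ∖ B} S μ − Σ_{B ∖ (B − e_μ)} S μ)`: `S` paired with `∇1_B`, supported on the bonds crossing `∂B`.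
* §1 `toSite_update_pred`, **`boxSum_sub_shift_eq_faces`** — for ANY `f : Site (d+1) → G` into an additive commutative group and each direction `μ`:
  `Σ_{v ∈ box} (f (N•y + v − e_μ) − f (N•y + v)) = Σ_{v ∈ box, v μ = 0} f (N•y + v − e_μ) − Σ_{v ∈ box, v μ = N−1} f (N•y + v)` (telescoping along `μ`
  by the shift bijection `v ↦ v − δ_μ` between `{v μ ≥ 1}` and `{w μ ≤ N − 2}`).
* §1b `card_face_eq` — each face has `N^d` sites (`k < N`): the count behind the layer fraction `1∕N`.
* §2 **`boxSum_divV_eq_faceFlux`** — for an `MKer`-valued first-order family `S`: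
  `Σ_{v ∈ box (d+1) N} divV S (N•y + toSite v) = Σ_μ (Σ_{v ∈ box, v μ = 0} S μ (N•y + toSite v − e_μ) − Σ_{v ∈ box, v μ = N−1} S μ (N•y + toSite v))`
  (`KernelWard.divV` is the backward divergence `Σ_μ (S μ (p − e_μ) − S μ p)`): THE BLOCK-SUMMED FINE DIVERGENCE IS THE NET FLUX OF `S` INTO `B(y)` THROUGH
  ITS `2(d+1)` FACES — every interior bond cancels; the bi-table slot forms are the instances `S μ p := T μ p κ′ u′` ∕ `S := T κ u`.
* §3 THE STOREY MAPS SEE ONLY FACE DATA: **`divW_lin4_of_symm_faceFlux`** (PART 1's `Lin4SlotDivergence.divW_lin4_of_symm` with its block-summed family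
  rewritten as the face flux: `divW (lin4 c K N T) y ν y′ = (c·cH) • e3OfK N K (κ u ↦ Σ_μ (Σ_{entering} T κ u μ (·−e_μ) − Σ_{exiting} T κ u μ ·)) ν y′`),
  **`divV_e3OfK_faceFlux`** (PART 2's `E3SlotDivergence.divV_e3OfK` likewise) — the |S| = 1 and |S| = 2 storey inputs of WC-TL ∕ (Q-R) are
  `2(d+1)·N^d`-term face sums, NOT `N^{d+1}`-term block sums: the located source of WARD5's layer fraction `∝ 1∕N`.

Asserts NO estimate and NO shape of Bałaban's tables; decides nothing about (Q-R) ∕ (Q-L) ∕ (C); discharges NOTHING of «T2Shape» ∕ «T2Drift» ∕ (hW, hWall);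
0 wall binders; NEVER «G-an2-4 closed» as (CONV-C); NOT D1, NOT `BetaPertH`, NOT continuum, NOT Clay; not in print — our bookkeeping.  Unit
`b2b-balaban-gan24-formalise-leaf-03` (gen 58), 2026-08-22.
-/

noncomputable section

open Finset
open scoped BigOperators
open Literature.MathematicalPhysics.QuantumFieldTheory
open Literature.MathematicalPhysics.QuantumFieldTheory.Balaban1983to89
open Literature.MathematicalPhysics.QuantumFieldTheory.Balaban1983to89.Beta
open B6BondElimination (unitVec unitVec_apply)
open ExpKernelCalculus (MKer Site Decays comp)
open OneStepResolventKernel (Fib)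
open OneStepKernelFamily (colH vertexOfK KInvStep)
open BalabanStepJetsSucc (mmRead)
open KernelWard (divV divW)
open AffineAveraging (box toSite)
open Summit.QuantumFields.BalabanUV.Beta.KernelWardRelative (gaugeWt)
open Summit.QuantumFields.BalabanUV.Beta.GAN24.T2RecursionAffine (lin4)
open Summit.QuantumFields.BalabanUV.Beta.SpineRooted (e3OfK)
open Summit.QuantumFields.BalabanUV.Beta.GAN24.Lin4SlotDivergence (divW_lin4_of_symm)
open Summit.QuantumFields.BalabanUV.Beta.GAN24.E3SlotDivergence (divV_e3OfK)

namespace Summit.QuantumFields.BalabanUV.Beta.GAN24.BlockDivergenceFlux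

variable {d N : ℕ}

/-! ## §0 Any finite region: the sum of a backward divergence over `B` is the ENTERING layer minus the EXITING layer (`F` paired with `∇1_B`) -/

/-- [folklore] **SUM OF SHIFT-DIFFERENCES OVER ANY FINITE REGION** (the OWNER gan24-p1 g25's requested general form, W2 (LAY)): for a finite set `B` of sites,
any `f : Site → G` into an additive commutative group and any translation `e`,
`Σ_{u ∈ B} (f (u − e) − f u) = Σ_{w ∈ (B − e) ∖ B} f w − Σ_{u ∈ B ∖ (B − e)} f u` (`B − e := B.image (· − e)`): the doubly covered sites cancel; what remains is
the layer ENTERING `B` against `e` minus the layer EXITING it — for `e = e_μ` and `f = F μ` this is `F μ` paired with the `μ`-component of `∇1_B`. -/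
theorem finsetSum_sub_shift_eq_layers {G : Type*} [AddCommGroup G] (B : Finset (Site (d + 1))) (f : Site (d + 1) → G) (e : Site (d + 1)) :
    ∑ u ∈ B, (f (u - e) - f u)
      = ∑ w ∈ B.image (fun u => u - e) \ B, f w - ∑ u ∈ B \ B.image (fun u => u - e), f u := by
  classical
  rw [Finset.sum_sub_distrib, ← Finset.sum_image (f := f) (s := B) (g := fun u => u - e) (fun x _ y _ h => sub_left_injective h)]
  have hA : ∑ w ∈ B.image (fun u => u - e), f w
      = ∑ w ∈ B.image (fun u => u - e) \ B, f w + ∑ w ∈ B.image (fun u => u - e) ∩ B, f w := by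
    rw [← Finset.sum_union (Finset.disjoint_sdiff_inter _ _), Finset.sdiff_union_inter]
  have hB : ∑ u ∈ B, f u = ∑ u ∈ B \ B.image (fun u => u - e), f u + ∑ u ∈ B ∩ B.image (fun u => u - e), f u := by
    rw [← Finset.sum_union (Finset.disjoint_sdiff_inter _ _), Finset.sdiff_union_inter]
  rw [hA, hB, Finset.inter_comm]
  abel

/-- [folklore] **THE SUM OF A BACKWARD DIVERGENCE OVER ANY FINITE REGION IS THE NET FLUX THROUGH ITS BOUNDARY LAYERS**: for an `MKer`-valued first-order family `S`
and any finite `B` (e.g. a finite union of blocks), `Σ_{u ∈ B} divV S u = Σ_μ (Σ_{w ∈ (B − e_μ) ∖ B} S μ w − Σ_{u ∈ B ∖ (B − e_μ)} S μ u)` — `S` paired with `∇1_B`,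
supported on the bonds crossing `∂B`. -/
theorem finsetSum_divV_eq_layers (B : Finset (Site (d + 1))) (S : Fin (d + 1) → Site (d + 1) → MKer (d + 1) (Fib d)) :
    ∑ u ∈ B, divV S u
      = ∑ μ, (∑ w ∈ B.image (fun u => u - unitVec μ) \ B, S μ w - ∑ u ∈ B \ B.image (fun u => u - unitVec μ), S μ u) := by
  simp only [KernelWard.divV]
  rw [Finset.sum_comm]
  exact Finset.sum_congr rfl fun μ _ => finsetSum_sub_shift_eq_layers B (S μ) (unitVec μ)

/-! ## §1 Telescoping along one direction of the block -/

/-- [folklore] Lowering the `μ`-th offset by one (when positive) is the lattice translation by `−e_μ`. -/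
theorem toSite_update_pred (v : Fin (d + 1) → ℕ) (μ : Fin (d + 1)) (h : 1 ≤ v μ) :
    toSite (Function.update v μ (v μ - 1)) = toSite v - unitVec μ := by
  funext i
  simp only [toSite, Pi.sub_apply, unitVec_apply]
  by_cases hi : i = μ
  · subst hi
    rw [Function.update_self, if_pos rfl, Nat.cast_sub h, Nat.cast_one]
  · rw [Function.update_of_ne hi, if_neg hi, sub_zero]

/-- [folklore] **TELESCOPING ALONG ONE DIRECTION OF A BLOCK**: for any `f : Site → G` (`G` an additive commutative group), `N ≥ 1`, a coarse site `y`
and a direction `μ`, `Σ_{v ∈ box} (f (N•y + v − e_μ) − f (N•y + v)) = Σ_{v ∈ box, v μ = 0} f (N•y + v − e_μ) − Σ_{v ∈ box, v μ = N−1} f (N•y + v)` —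
the interior terms cancel under the shift `v ↦ v − δ_μ` (a bijection `{v μ ≥ 1} → {w μ ≤ N−2}` inside the box); what remains is the ENTERING face
(the layer just below the block in direction `μ`) minus the EXITING face (the top layer of the block). -/
theorem boxSum_sub_shift_eq_faces {G : Type*} [AddCommGroup G] (hN : 1 ≤ N) (f : Site (d + 1) → G) (y : Site (d + 1)) (μ : Fin (d + 1)) :
    ∑ v ∈ box (d + 1) N, (f ((N : ℤ) • y + toSite v - unitVec μ) - f ((N : ℤ) • y + toSite v))
      = ∑ v ∈ (box (d + 1) N).filter (fun v => v μ = 0), f ((N : ℤ) • y + toSite v - unitVec μ)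
        - ∑ v ∈ (box (d + 1) N).filter (fun v => v μ = N - 1), f ((N : ℤ) • y + toSite v) := by
  classical
  rw [Finset.sum_sub_distrib, ← Finset.sum_filter_add_sum_filter_not (box (d + 1) N) (fun v => v μ = 0),
    ← Finset.sum_filter_add_sum_filter_not (box (d + 1) N) (fun v => v μ = N - 1)]
  -- the two interior sums agree under the shift bijection
  have key : ∑ v ∈ (box (d + 1) N).filter (fun v => ¬v μ = 0), f ((N : ℤ) • y + toSite v - unitVec μ)
      = ∑ w ∈ (box (d + 1) N).filter (fun w => ¬w μ = N - 1), f ((N : ℤ) • y + toSite w) := by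
    refine Finset.sum_nbij' (fun v => Function.update v μ (v μ - 1)) (fun w => Function.update w μ (w μ + 1)) ?_ ?_ ?_ ?_ ?_
    · intro v hv
      simp only [Finset.mem_filter, AffineAveraging.box, Fintype.mem_piFinset, Finset.mem_range] at hv ⊢
      obtain ⟨hb, h0⟩ := hv
      refine ⟨fun i => ?_, ?_⟩
      · by_cases hi : i = μ
        · subst hi; rw [Function.update_self]; have := hb i; omega
        · rw [Function.update_of_ne hi]; exact hb i
      · rw [Function.update_self]; have := hb μ; omega
    · intro w hw
      simp only [Finset.mem_filter, AffineAveraging.box, Fintype.mem_piFinset, Finset.mem_range] at hw ⊢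
      obtain ⟨hb, hN1⟩ := hw
      refine ⟨fun i => ?_, ?_⟩
      · by_cases hi : i = μ
        · subst hi; rw [Function.update_self]; have := hb i; omega
        · rw [Function.update_of_ne hi]; exact hb i
      · rw [Function.update_self]; omega
    · intro v hv
      simp only [Finset.mem_filter] at hv
      funext i
      by_cases hi : i = μ
      · subst hi; simp only [Function.update_self]; omega
      · simp only [Function.update_of_ne hi]
    · intro w _
      funext i
      by_cases hi : i = μ
      · subst hi; simp only [Function.update_self, Nat.add_sub_cancel]
      · simp only [Function.update_of_ne hi]
    · intro v hv
      simp only [Finset.mem_filter] at hv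
      rw [toSite_update_pred v μ (by omega), add_sub_assoc]
  rw [key]
  abel

/-- [folklore] **EACH FACE OF THE BLOCK HAS `N^d` SITES**: for `k < N`, `#{v ∈ box (d+1) N ∣ v μ = k} = N^d` (the face is the product finset with the `μ`-th
factor replaced by `{k}`; `Fintype.card_piFinset`) — the count behind the layer fraction `N^d ∕ N^{d+1} = 1∕N`. -/
theorem card_face_eq {k : ℕ} (hk : k < N) (μ : Fin (d + 1)) :
    ((box (d + 1) N).filter (fun v => v μ = k)).card = N ^ d := by
  classical
  have e : (box (d + 1) N).filter (fun v => v μ = k) = Fintype.piFinset (fun i => if i = μ then ({k} : Finset ℕ) else Finset.range N) := by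
    ext v
    simp only [Finset.mem_filter, AffineAveraging.box, Fintype.mem_piFinset, Finset.mem_range]
    constructor
    · rintro ⟨hb, hμ⟩ i
      by_cases hi : i = μ
      · subst hi; rw [if_pos rfl, Finset.mem_singleton]; exact hμ
      · rw [if_neg hi, Finset.mem_range]; exact hb i
    · intro h
      refine ⟨fun i => ?_, ?_⟩
      · have hi := h i
        by_cases hiμ : i = μ
        · subst hiμ; rw [if_pos rfl, Finset.mem_singleton] at hi; rw [hi]; exact hk
        · rw [if_neg hiμ, Finset.mem_range] at hi; exact hi
      · have hμ := h μ
        rw [if_pos rfl, Finset.mem_singleton] at hμ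
        exact hμ
  rw [e, Fintype.card_piFinset]
  have e2 : ∀ i : Fin (d + 1), ((if i = μ then ({k} : Finset ℕ) else Finset.range N)).card = if i = μ then 1 else N := by
    intro i
    by_cases hi : i = μ
    · rw [if_pos hi, if_pos hi, Finset.card_singleton]
    · rw [if_neg hi, if_neg hi, Finset.card_range]
  simp only [e2]
  rw [← Finset.mul_prod_erase Finset.univ _ (Finset.mem_univ μ), if_pos rfl, one_mul,
    Finset.prod_congr rfl (fun i hi => if_neg (Finset.ne_of_mem_erase hi)), Finset.prod_const, Finset.card_erase_of_mem (Finset.mem_univ μ),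
    Finset.card_univ, Fintype.card_fin, Nat.add_sub_cancel]

/-! ## §2 The block sum of the backward divergence of an `MKer`-valued family is its face flux -/

/-- [folklore] **THE BLOCK-SUMMED FINE DIVERGENCE IS THE FACE FLUX**: for a first-order family `S : Fin (d+1) → Site → MKer` (pv's backward divergence
`KernelWard.divV S p = Σ_μ (S μ (p − e_μ) − S μ p)`), `N ≥ 1`, every coarse site `y`:
`Σ_{v ∈ box (d+1) N} divV S (N•y + toSite v) = Σ_μ (Σ_{v ∈ box, v μ = 0} S μ (N•y + toSite v − e_μ) − Σ_{v ∈ box, v μ = N−1} S μ (N•y + toSite v))` —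
the net flux of `S` INTO the block `B(y)` through its `2(d+1)` faces; the slot forms of a bi-table are the instances `S μ p := T μ p κ′ u′` (first slot,
`κ′ u′` frozen) and `S := T κ u` (second slot). -/
theorem boxSum_divV_eq_faceFlux (hN : 1 ≤ N) (S : Fin (d + 1) → Site (d + 1) → MKer (d + 1) (Fib d)) (y : Site (d + 1)) :
    ∑ v ∈ box (d + 1) N, divV S ((N : ℤ) • y + toSite v)
      = ∑ μ, (∑ v ∈ (box (d + 1) N).filter (fun v => v μ = 0), S μ ((N : ℤ) • y + toSite v - unitVec μ)
          - ∑ v ∈ (box (d + 1) N).filter (fun v => v μ = N - 1), S μ ((N : ℤ) • y + toSite v)) := by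
  simp only [KernelWard.divV]
  rw [Finset.sum_comm]
  exact Finset.sum_congr rfl fun μ _ => boxSum_sub_shift_eq_faces hN (S μ) y μ

/-! ## §3 The storey maps of T-EQ see only the face data of the table -/

section Storey

variable [NeZero N] {K : MKer (d + 1) (Fib d)} {C δ : ℝ}
  {T : Fin (d + 1) → (Fin (d + 1) → ℤ) → Fin (d + 1) → (Fin (d + 1) → ℤ) → MKer (d + 1) (Fib d)} {B : ℝ} {cH : ℝ}

omit [NeZero N] in
/-- [folklore] `N ≠ 0 → 1 ≤ N`, for the `[NeZero N]` instances below. -/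
theorem one_le_of_neZero' [NeZero N] : 1 ≤ N := Nat.one_le_iff_ne_zero.2 (NeZero.ne N)

/-- [folklore] **T-EQ, SOURCE SLOT, FACE FORM**: PART 1's `divW_lin4_of_symm` with the block-summed fine divergence rewritten as the face flux — the coarse
slot divergence of the linear step reads the symmetric table ONLY through its inner-slot values on the `2(d+1)` faces of `B(y)`:
`divW (lin4 c K N T) y ν y′ = (c·cH) • e3OfK N K (κ u ↦ Σ_μ (Σ_{v: v μ = 0} T κ u μ (N•y + v − e_μ) − Σ_{v: v μ = N−1} T κ u μ (N•y + v))) ν y′`. -/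
theorem divW_lin4_of_symm_faceFlux (hK : Decays K C δ) (hδ : 0 < δ) (c : ℝ) (hT : ∀ κ u κ' u' x z a b, |T κ u κ' u' x z a b| ≤ B)
    (hsym : ∀ κ u κ' u', T κ u κ' u' = T κ' u' κ u)
    (hH : ∀ (y : Fin (d + 1) → ℤ) (κ' : Fin (d + 1)) (u : Fin (d + 1) → ℤ),
      ∑ μ, (colH K N μ (y - unitVec μ) κ' u - colH K N μ y κ' u) = cH * gaugeWt N y κ' u)
    (y : Fin (d + 1) → ℤ) (ν : Fin (d + 1)) (y' : Fin (d + 1) → ℤ) :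
    divW (lin4 c K N T) y ν y'
      = (c * cH) • e3OfK N K (fun κ u => ∑ μ, (∑ v ∈ (box (d + 1) N).filter (fun v => v μ = 0), T κ u μ ((N : ℤ) • y + toSite v - unitVec μ)
          - ∑ v ∈ (box (d + 1) N).filter (fun v => v μ = N - 1), T κ u μ ((N : ℤ) • y + toSite v))) ν y' := by
  rw [divW_lin4_of_symm hK hδ c hT hsym hH y ν y']
  have e : (fun κ u => ∑ v ∈ box (d + 1) N, divV (T κ u) ((N : ℤ) • y + toSite v))
      = fun κ u => ∑ μ, (∑ v ∈ (box (d + 1) N).filter (fun v => v μ = 0), T κ u μ ((N : ℤ) • y + toSite v - unitVec μ)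
          - ∑ v ∈ (box (d + 1) N).filter (fun v => v μ = N - 1), T κ u μ ((N : ℤ) • y + toSite v)) := by
    funext κ u
    exact boxSum_divV_eq_faceFlux one_le_of_neZero' (T κ u) y
  rw [e]

omit [NeZero N] in
/-- [folklore] **T-EQ FOR THE S-STEP, FACE FORM**: PART 2's `divV_e3OfK` with the block-summed fine divergence rewritten as the face flux — the slot
divergence of the S-step map reads a bounded stencil family ONLY through its values on the faces of `B(y)`:
`divV (e3OfK N K S) y = −(cH • mmRead N (K ∘ (Σ_μ (Σ_{v: v μ = 0} S μ (N•y + v − e_μ) − Σ_{v: v μ = N−1} S μ (N•y + v))) ∘ K))`. -/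
theorem divV_e3OfK_faceFlux (hK : Decays K C δ) (hδ : 0 < δ) (hN : 1 ≤ N) {S : Fin (d + 1) → (Fin (d + 1) → ℤ) → MKer (d + 1) (Fib d)}
    (hS : ∀ κ u x z a b, |S κ u x z a b| ≤ B)
    (hH : ∀ (y : Fin (d + 1) → ℤ) (κ' : Fin (d + 1)) (u : Fin (d + 1) → ℤ),
      ∑ μ, (colH K N μ (y - unitVec μ) κ' u - colH K N μ y κ' u) = cH * gaugeWt N y κ' u)
    (y : Fin (d + 1) → ℤ) :
    divV (e3OfK N K S) y
      = -(cH • mmRead N (comp (comp K (∑ μ, (∑ v ∈ (box (d + 1) N).filter (fun v => v μ = 0), S μ ((N : ℤ) • y + toSite v - unitVec μ)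
          - ∑ v ∈ (box (d + 1) N).filter (fun v => v μ = N - 1), S μ ((N : ℤ) • y + toSite v)))) K)) := by
  rw [divV_e3OfK hK hδ hN hS hH y, boxSum_divV_eq_faceFlux hN S y]

end Storey

end Summit.QuantumFields.BalabanUV.Beta.GAN24.BlockDivergenceFlux

end
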